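/-
Origin: expansion seat `planner-pub-hodgecm-mc-axioms-1-g14-0`, handover #W254 2026-08-20T15:53:55Z md5 684b3937391f (PKG 6579b7038571 → 684b3937391f; 162 l.; MECHANICAL (iib-R) rewrite v3.1 of the PKG file as it stands (39 token edits; rules R1x1+RX[h₂]x38)) (`HOME/mc/pub-hodgecm-mc-axioms-1-g14/revendor/kit-r55/stage55/HodgeCM/Model/Binders/Gen12WedgeKType.lean`, md5 684b3937391f, 162 lines);
landed by the gen-22 packager (p-g22) in gate run 55 REPLACES the earlier landed copy of `HodgeCM/Model/Binders/Gen12WedgeKType.lean` (seat copy carried the packager Origin header of an earlier run (stripped)).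
-/
/-
Origin: speedrun cell pub-hodgecm, MODEL-CONSTRUCTION sub-cell, unit pub-hodgecm-mc-binder-1-g7 (BINDER PROVER, gen 7; node
B2-meet, BINDER-OWNERS row 14, clause (SS-K) of RECORD 2′ — the PKG junction skeleton of BINDER-TRIAGE §63.2/§64), seat
prover-pub-hodgecm-mc-binder-1-g7-0, 2026-08-19.
Target in PKG: HodgeCM/Model/Binders/Gen12WedgeKType.lean (NEW additive leaf; imports kit #11 `Model/Binders/Gen12SeesawOp` only; nothing landed
imports it).  KERNEL ONLY: 0 records of published theorems, nothing cited, 0 `def … : Prop`, MODEL-N ±0.  The tree twin of § 1 is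
`Literature/NumberTheory/GelbartRogawski1991/UnitaryDualPairSeesawWedgeCMKType.wedgePair_mem_kappaIsotypic` (p189851); restated here in E's
currency (abstract `W`, `S`) because `Literature.RepresentationTheory.WedgePairDeterminant` is not vendored.
-/
import Summits.HodgeConjecture.HodgeCM.Model.Binders.Gen12SeesawOp

/-!
# (SS-K) at the pin: the wedge test function lies in `𝒮^κ` — junction skeleton

RECORD 2′ `SeesawCore … adm = {τ, seesaw (SS), wedge_mem (SS-K)}`; after `Gen12SeesawOp` ((SS) from the operator-level restriction (x-S))
the one clause of row `gen12` that is not definitional at the honest pin is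

  (SS-K) `wedge_mem : ∀ Γ Sit₀ Sit₁, adm Γ 0 Sit₀ → adm Γ 1 Sit₁ → ∀ j₀ ∈ Sit₀.𝓙, ∀ j₁ ∈ Sit₁.𝓙,
            τ φ₀⁰ φ₁¹ − τ φ₀¹ φ₁⁰ ∈ (W V c).SK`,   `φₐⁱ := jₐ (Sitₐ.ι (proj i))`.

This leaf proves it (**`wedgeMem_of_kType`**) from four junction hypotheses, each in the shape its producer exports (BINDER-TRIAGE §63.2,
model1 §64, theta-3-g8 15:09:56Z):

* (x-S)₁  `op1` — the operator-level restriction at `t = 1` along a family `gK : Kι → G_U(𝔸)` (= `Gen12SeesawOp.op_one` of period-1's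
  `P_omega_eq_restrict`): `W.ρ(eV (gK k), 1) (τ φ₁ φ₂) = τ (P₀.ω(gK k, 1) φ₁) (P₁.ω(gK k, 1) φ₂)`;
* (x-W)  `hSK` — the W-side: every `χ`-weight vector of the family `k ↦ W.ρ(eV (gK k), 1)` lies in `(W V c).SK` (honest `W`:
  `wmInputCM₂_SK` + `mem_cmKTypeTwist_iff` + the currency identity `cmKTypeHom ∘ arch = eV ∘ gK`, `χ = archKappa`, `Kι = K_∞`);
* (x-Θ)  `hA`, `hB` — the S-side: the test pairs of ADMISSIBLE (strict, saturated) situations of the two lines transform under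
  `P₀.ω(gK k, 1)`, `P₁.ω(gK k, 1)` through the SAME matrices `m k` (theta-3's (E4) `IsStrict.act_family_arch_mul` at the `ι₁`-factor,
  (E2) `act_family_eq_self` on `ker π_τ` × the finite level, after the factorisation `gK k = ιinf Γ (κ₁ (π k)) · a_k`);
* (K-norm)/(c5)  `hdet` — `det (m k) = χ k` (unitary-1's W2-Kn integers at `ι₁`, (N-S) at the definite places).

§ 1 is the `2 × 2` determinant law (`∧²` of a two-dimensional representation is `det`; Fulton–Harris Lecture 6), § 2 the junction theorem and
the constructor **`SeesawCore.ofKType`** (= `SeesawCore.ofOp` with (SS-K) discharged).  Nothing here is a claim of the manuscripts under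
adjudication.
-/

set_option autoImplicit false

noncomputable section

open MeasureTheory NumberField

namespace HodgeCM.Model

open HodgeCM HodgeCM.Universe
open Literature.NumberTheory.Weil1964
open Literature.NumberTheory.Automorphic (piSchwartzBruhat)
open Literature.AlgebraicGeometry.HodgeTheory
open Literature.NumberTheory.Automorphic.PicardCM
open Literature.NumberTheory.Transcendental (Arapura2012_Cor_15_4_6)
open HodgeCM.Model.ThetaSpace

/-! ## 1. The `2 × 2` determinant law for a bilinear pairing -/

section Det

variable {S₁ S₂ S₃ : Type*} [AddCommGroup S₁] [Module ℂ S₁] [AddCommGroup S₂] [Module ℂ S₂] [AddCommGroup S₃] [Module ℂ S₃]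

/-- **`∧²` of a two-dimensional action is the determinant**: if both pairs `a, b` transform under `A, B` through the same matrix `m`
(`A (a i) = Σ_j m j i • a j`, `B (b i) = Σ_j m j i • b j`), then `τ (A a₀) (B b₁) − τ (A a₁) (B b₀) = det m • (τ a₀ b₁ − τ a₁ b₀)`. -/
theorem wedge_of_matrix (τ : S₁ →ₗ[ℂ] S₂ →ₗ[ℂ] S₃) (a : Fin 2 → S₁) (b : Fin 2 → S₂) (m : Matrix (Fin 2) (Fin 2) ℂ)
    (A : S₁ →ₗ[ℂ] S₁) (B : S₂ →ₗ[ℂ] S₂) (hA : ∀ i, A (a i) = ∑ j, m j i • a j) (hB : ∀ i, B (b i) = ∑ j, m j i • b j) :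
    τ (A (a 0)) (B (b 1)) - τ (A (a 1)) (B (b 0)) = m.det • (τ (a 0) (b 1) - τ (a 1) (b 0)) := by
  simp only [hA, hB, Fin.sum_univ_two, map_add, map_smul, LinearMap.add_apply, LinearMap.smul_apply, Matrix.det_fin_two]
  module

end Det

/-! ## 2. (SS-K) from the four junction hypotheses -/

variable (hHD : exists_isReal_hodgeModel) (hI : hodgePQ_independent_of_hodgeModel)
  (h₁ : BallQuotientUniformised)  (h₃ : CMAbelianVarietyRealised)
variable (W : ∀ {L : CMField} {ι₁ : L →+* ℂ} (V : HermSpace3 L ι₁) (c : SeesawCtx L), WmInput V c.D)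
  (S : ∀ {L : CMField} {ι₁ : L →+* ℂ} (V : HermSpace3 L ι₁) (c : SeesawCtx L), ThetaAdelicSide V c)
variable {L : CMField} {ι₁ : L →+* ℂ} (V : HermSpace3 L ι₁) (c : SeesawCtx L) (hV : IsAnisotropic L V.Hm)

local notation3 "L⁺" => maximalRealSubfield (L : Type)

/- the ADMISSIBILITY predicate on `K`-type situations (`Gen12Residual.Adm`; at the (Θ-sat) pin: saturated at the level's compact open and
strict) -/
variable (adm : ∀ (Γ : Level V) (k : Fin 4),
    KTypeSituation ((pinX hHD hI h₁ h₃ S V c hV).P k) ((pinX hHD hI h₁ h₃ S V c hV).ιinf Γ)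
      ((pinX hHD hI h₁ h₃ S V c hV).Δ Γ) (pinX hHD hI h₁ h₃ S V c hV).κ₁ (pinX hHD hI h₁ h₃ S V c hV).τ₁ → Prop)

/-- **(SS-K) from (x-S)₁, (x-W), (x-Θ) and the determinant bookkeeping.**  Along a family `gK : Kι → G_U(𝔸)` (model case: the
archimedean isotropy `K_∞` of the base point, read in the regime model): if `W.ρ(eV (gK k), 1)` restricts on the nose to the two small pair
actions on the bilinear pairing `τ` (`op1`), if every `χ`-weight vector of that family lies in `𝒮^κ = (W V c).SK` (`hSK`), and if the test
pairs of every ADMISSIBLE situation of line `0` (resp. `1`) transform under `P₀.ω(gK k, 1)` (resp. `P₁.ω(gK k, 1)`) through one matrix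
`m k` with `det (m k) = χ k` (`hA`, `hB`, `hdet`), then the wedge test function of any two admissible situations lies in `𝒮^κ`. -/
theorem wedgeMem_of_kType {Kι : Type*} (gK : Kι → ↥(Adelic.regimeSubgroup L V.Hm)) (χ : Kι → ℂ)
    (τ : piSchwartzBruhat L⁺ (Fin 3) →ₗ[ℂ] piSchwartzBruhat L⁺ (Fin 3) →ₗ[ℂ] piSchwartzBruhat (W V c).F (W V c).ι)
    (op1 : ∀ (k : Kι) (φ₁ φ₂ : piSchwartzBruhat L⁺ (Fin 3)),
      (((W V c).ρ ((W V c).eV (gK k : ↥(Adelic.adelicUnitaryGroup L V.Hm)), 1)) :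
          Module.End ℂ (piSchwartzBruhat (W V c).F (W V c).ι)) (τ φ₁ φ₂) =
        τ (((S V c).P 0).ω (gK k, 1) φ₁) (((S V c).P 1).ω (gK k, 1) φ₂))
    (hSK : ∀ Ψ : piSchwartzBruhat (W V c).F (W V c).ι,
      (∀ k : Kι, (((W V c).ρ ((W V c).eV (gK k : ↥(Adelic.adelicUnitaryGroup L V.Hm)), 1)) :
          Module.End ℂ (piSchwartzBruhat (W V c).F (W V c).ι)) Ψ = χ k • Ψ) → Ψ ∈ (W V c).SK)
    (m : Kι → Matrix (Fin 2) (Fin 2) ℂ) (hdet : ∀ k : Kι, (m k).det = χ k)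
    (hA : ∀ (Γ : Level V)
      (Sit : KTypeSituation ((pinX hHD hI h₁ h₃ S V c hV).P 0) ((pinX hHD hI h₁ h₃ S V c hV).ιinf Γ)
        ((pinX hHD hI h₁ h₃ S V c hV).Δ Γ) (pinX hHD hI h₁ h₃ S V c hV).κ₁ (pinX hHD hI h₁ h₃ S V c hV).τ₁),
      adm Γ 0 Sit → ∀ j ∈ Sit.𝓙, ∀ (k : Kι) (i : Fin 2),
        ((S V c).P 0).ω (gK k, 1) (j.1 (Sit.ι (LinearMap.proj i))) = ∑ l, m k l i • j.1 (Sit.ι (LinearMap.proj l)))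
    (hB : ∀ (Γ : Level V)
      (Sit : KTypeSituation ((pinX hHD hI h₁ h₃ S V c hV).P 1) ((pinX hHD hI h₁ h₃ S V c hV).ιinf Γ)
        ((pinX hHD hI h₁ h₃ S V c hV).Δ Γ) (pinX hHD hI h₁ h₃ S V c hV).κ₁ (pinX hHD hI h₁ h₃ S V c hV).τ₁),
      adm Γ 1 Sit → ∀ j ∈ Sit.𝓙, ∀ (k : Kι) (i : Fin 2),
        ((S V c).P 1).ω (gK k, 1) (j.1 (Sit.ι (LinearMap.proj i))) = ∑ l, m k l i • j.1 (Sit.ι (LinearMap.proj l))) :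
    ∀ (Γ : Level V)
      (Sit₀ : KTypeSituation ((pinX hHD hI h₁ h₃ S V c hV).P 0) ((pinX hHD hI h₁ h₃ S V c hV).ιinf Γ)
        ((pinX hHD hI h₁ h₃ S V c hV).Δ Γ) (pinX hHD hI h₁ h₃ S V c hV).κ₁ (pinX hHD hI h₁ h₃ S V c hV).τ₁)
      (Sit₁ : KTypeSituation ((pinX hHD hI h₁ h₃ S V c hV).P 1) ((pinX hHD hI h₁ h₃ S V c hV).ιinf Γ)
        ((pinX hHD hI h₁ h₃ S V c hV).Δ Γ) (pinX hHD hI h₁ h₃ S V c hV).κ₁ (pinX hHD hI h₁ h₃ S V c hV).τ₁),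
      adm Γ 0 Sit₀ → adm Γ 1 Sit₁ → ∀ j₀ ∈ Sit₀.𝓙, ∀ j₁ ∈ Sit₁.𝓙,
        τ (j₀.1 (Sit₀.ι (LinearMap.proj 0))) (j₁.1 (Sit₁.ι (LinearMap.proj 1))) -
          τ (j₀.1 (Sit₀.ι (LinearMap.proj 1))) (j₁.1 (Sit₁.ι (LinearMap.proj 0))) ∈ (W V c).SK := by
  intro Γ Sit₀ Sit₁ had₀ had₁ j₀ hj₀ j₁ hj₁
  apply hSK
  intro k
  rw [map_sub, op1, op1, ← hdet k]
  exact wedge_of_matrix τ (fun i => j₀.1 (Sit₀.ι (LinearMap.proj i))) (fun i => j₁.1 (Sit₁.ι (LinearMap.proj i))) (m k)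
    (((S V c).P 0).ω (gK k, 1)) (((S V c).P 1).ω (gK k, 1)) (hA Γ Sit₀ had₀ j₀ hj₀ k) (hB Γ Sit₁ had₁ j₁ hj₁ k)

/-- **RECORD 2′ with (SS-K) discharged**: `SeesawCore.ofOp` (kit #11: (SS) from the operator-level restriction `op` + the product rule `prod`)
with `wedge_mem := wedgeMem_of_kType …` — the see-saw record of row `gen12` from (x-S) `op`/`prod`, (x-W) `hSK`, (x-Θ) `hA`/`hB` and
`hdet` only. -/
def SeesawCore.ofKType {Kι : Type*} (gK : Kι → ↥(Adelic.regimeSubgroup L V.Hm)) (χ : Kι → ℂ)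
    (τ : piSchwartzBruhat L⁺ (Fin 3) →ₗ[ℂ] piSchwartzBruhat L⁺ (Fin 3) →ₗ[ℂ] piSchwartzBruhat (W V c).F (W V c).ι)
    (prod : ∀ φ₁ φ₂ : piSchwartzBruhat L⁺ (Fin 3),
      thetaDistLM (W V c).F (W V c).ι (τ φ₁ φ₂) = thetaDistLM L⁺ (Fin 3) φ₁ * thetaDistLM L⁺ (Fin 3) φ₂)
    (op : ∀ (g : ↥(Adelic.regimeSubgroup L V.Hm)) (t : SeesawTorus L⁺ L) (φ₁ φ₂ : piSchwartzBruhat L⁺ (Fin 3)),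
      (((W V c).ρ ((W V c).eV (g : ↥(Adelic.adelicUnitaryGroup L V.Hm)), (W V c).eW (c.D.jT₁₂ t))) :
          Module.End ℂ (piSchwartzBruhat (W V c).F (W V c).ι)) (τ φ₁ φ₂) =
        τ (((S V c).P 0).ω (g, SeesawTorus.fst L⁺ L t) φ₁) (((S V c).P 1).ω (g, SeesawTorus.snd L⁺ L t) φ₂))
    (hSK : ∀ Ψ : piSchwartzBruhat (W V c).F (W V c).ι,
      (∀ k : Kι, (((W V c).ρ ((W V c).eV (gK k : ↥(Adelic.adelicUnitaryGroup L V.Hm)), 1)) :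
          Module.End ℂ (piSchwartzBruhat (W V c).F (W V c).ι)) Ψ = χ k • Ψ) → Ψ ∈ (W V c).SK)
    (m : Kι → Matrix (Fin 2) (Fin 2) ℂ) (hdet : ∀ k : Kι, (m k).det = χ k)
    (hA : ∀ (Γ : Level V)
      (Sit : KTypeSituation ((pinX hHD hI h₁ h₃ S V c hV).P 0) ((pinX hHD hI h₁ h₃ S V c hV).ιinf Γ)
        ((pinX hHD hI h₁ h₃ S V c hV).Δ Γ) (pinX hHD hI h₁ h₃ S V c hV).κ₁ (pinX hHD hI h₁ h₃ S V c hV).τ₁),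
      adm Γ 0 Sit → ∀ j ∈ Sit.𝓙, ∀ (k : Kι) (i : Fin 2),
        ((S V c).P 0).ω (gK k, 1) (j.1 (Sit.ι (LinearMap.proj i))) = ∑ l, m k l i • j.1 (Sit.ι (LinearMap.proj l)))
    (hB : ∀ (Γ : Level V)
      (Sit : KTypeSituation ((pinX hHD hI h₁ h₃ S V c hV).P 1) ((pinX hHD hI h₁ h₃ S V c hV).ιinf Γ)
        ((pinX hHD hI h₁ h₃ S V c hV).Δ Γ) (pinX hHD hI h₁ h₃ S V c hV).κ₁ (pinX hHD hI h₁ h₃ S V c hV).τ₁),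
      adm Γ 1 Sit → ∀ j ∈ Sit.𝓙, ∀ (k : Kι) (i : Fin 2),
        ((S V c).P 1).ω (gK k, 1) (j.1 (Sit.ι (LinearMap.proj i))) = ∑ l, m k l i • j.1 (Sit.ι (LinearMap.proj l))) :
    SeesawCore hHD hI h₁ h₃ W S V c hV adm :=
  SeesawCore.ofOp hHD hI h₁ h₃ W S V c hV adm τ prod op
    (wedgeMem_of_kType hHD hI h₁ h₃ W S V c hV adm gK χ τ
      (fun k φ₁ φ₂ => op_one W S V c τ op (gK k) φ₁ φ₂) hSK m hdet hA hB)

end HodgeCM.Model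

end
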